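import Literature.MathematicalPhysics.QuantumFieldTheory.Balaban1983to89.B8Eq158FlatTorus
import Literature.MathematicalPhysics.QuantumFieldTheory.Balaban1983to89.B5Prop12GHolds
import Literature.MathematicalPhysics.QuantumFieldTheory.Balaban1983to89.B5Prop11G0Torus
import Literature.MathematicalPhysics.QuantumFieldTheory.Balaban1983to89.B8ScaledSupNorm

/-!
# `Balaban1983to89.B8Ineq159FlatTorus` — T. Bałaban, *Spaces of regular gauge field configurations on a lattice and gauge
# fixing conditions*, Commun. Math. Phys. **99** (1985) 75–102 [Balaban1985RegularSpaces], (1.59) p. 86: the a-priori bound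
# «|A|₍₋₁₎, |∇^η_{U₀}A|₍₋₂₎, |D^{η*}_{U₀}D^η_{U₀}A|₍₋₃₎, |Δ^η_{U₀}A|₍₋₃₎ ≦ B₀(|J|₍₋₃₎ + |B₁|)» AT THE FLAT BACKGROUND U₀ = 1 for
# the constant domain sequence Ω₀ = … = Ω_k = T_η, on the tori of record — HYPOTHESIS-FREE, from [B5] (1.115) (row **B8.Eq1.59**)

statement-level skeleton of published theorems with citation tags; proofs where landed; nothing here is a claim about the Yang–Mills mass gap

PDF held: `paper:balaban1985-cmp99-regular-spaces-gauge-fixing` (journal page = PDF page + 74); p. 86 [PDF 12] read AS AN IMAGE this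
session (render `run/shared/lean/pub/pub-balaban/b2b-balaban-ref1/pages/1985-cmp99-regular-spaces-gauge-fixing-p012-x2.png`); [4] =
T. Bałaban, *Propagators for lattice gauge theories in a background field*, CMP **99** (1985) 389–434 [Balaban1985BackgroundPropagators]
pp. 398–399 [PDF 10–11] read as images (renders `…/1985-cmp99-background-propagators-p010-x2.png`, `-p011-x2.png`); [B5] = T. Bałaban,
*Propagators and renormalization transformations for lattice gauge theories. I*, CMP **95** (1984) 17–40 [Balaban1984PropagatorsI]
pp. 33–36 through the tree modules `B5` / `B5Prop12GHolds` / `B5Prop12FieldsLattice` (their verbatim quotations) and the text layer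
`paper:balaban1984-cmp95-propagators-rt-i` p0019–p0020.

CITATION HEADER (lean-in-tree rule).  Cell `lit-balaban`, unit `lit-balaban-r05` gen 15 (B8 fold owner); SKELETON row **B8.Eq1.59**
((1.59) p. 86; head «typed-existing»: the decl of record `B8FromB9.b8_159_transfer`/`b8_159_repaired` derives (1.59) from the NAMED LEAF
`B9.Thm33Printed` = [4] Theorem 3.3, whose proof — [4] Sects. C–E — is not in the tree).  THIS MODULE gives the first HYPOTHESIS-FREE
instance of the display: the flat background U₀ = 1 with B8's constant domain sequence (the setting of my gen-11 `B8Eq158FlatTorus`, SKELETON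
row B8.Eq1.58), where G(U₀) of (1.58) IS [B5]'s G = Δ_a⁻¹ (`B8Eq158FlatTorus.P8T_eq_DeltaA`, `G8T_eq_calG`) and [4]'s Theorem 3.3 at U = 1
reduces — for the three propagator members of (1.59) — to [B5]'s global sup-norm inequalities (1.115), which the tree PROVES hypothesis-free
for the torus family of record (p37 gen 7 `B5Prop12GHolds.global115_117_famG_printed`, on r02's real setting `B5SettingP12Real`).
Kind: theorems (+ no `… : Prop` fact, 0 sorry); every B5/B8 object consumed BY NAME.

WHAT IS PRINTED (verbatim, p. 86 [PDF 12]).  *"They imply finally A = G(U₀)J − G(U₀)D^{η*}_{U₀}D_{U₀}H(U₀)B₁ + H(U₀)B₁ =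
G(U₀)J + G(U₀)Σ_jQ*_jΛ_j(L^jη)⁻³B₁, (1.58) where the operator G(U₀) was introduced and investigated in [4]. Let us recall only the
definition: G(U₀) = (D^{η*}_{U₀}D^η_{U₀} + D^η_{U₀}R(U₀)D^{η*}_{U₀} + Σ_jQ*_jΛ_j(L^jη)⁻²Q_j)⁻¹.  Theorem 3.3 of [4] implies the bounds:
|A|₍₋₁₎, |∇^η_{U₀}A|₍₋₂₎, |D^{η*}_{U₀}D^η_{U₀}A|₍₋₃₎, |Δ^η_{U₀}A|₍₋₃₎ ≦ B₀(|J|₍₋₃₎ + |B₁|) ≦ B₀(2α₀ + 36dα₂|∇^η_{U₀}A|₍₋₂₎ + 50dα₂³ +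
10dα₀α₂ + 2dLα₁ + C₂α₂²). (1.59)"*; p. 86, after (1.55): *"D^{η*}_{U₀}D^η_{U₀}A = J, … where the norms | |₍α₎ were introduced in [4].
For the reader's convenience let us recall the definition: |A|₍α₎ = sup_j sup_{Ω_j}(L^jη)^{−α}|A|."*; Prop. 3 p. 87: *"where B₀, B₀(β₀)
are the corresponding norms of the operators G(U₀), H(U₀), and depend on d and L only"*.  [4] p. 398, (3.47): *"and the global
inequalities |G′(U)λ|₍₂₊γ₎, |∇_UG′(U)λ|₍₁₊γ₎, |G′(U)∇*_Uλ|₍₁₊γ₎, |∇_UG′(U)λ|₍γ₎ ≦ B₀|λ|₍γ₎ (3.47) for γ in a fixed compact subset of real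
numbers, e.g. for γ ∈ [−4, 4]."*; [4] p. 399, Theorem 3.3: *"Under the assumptions of Theorem 3.1, and with the constants described there,
the operator G(U) (a = 1) satisfies the inequalities (3.42)–(3.47), with G′(U) replaced by G(U) and λ replaced by a function J defined at
bonds of the lattice T_η, or Ω₀, and with values in 𝔤."*; p. 399: *"This way the theorems are reduced to the corresponding theorems for
propagators without external gauge field. They were proved in [4]."* ([4] of [4] = [B5]/[B6]).  [B5] p. 36, (1.115): *"The localized
inequalities (1.110)–(1.114) imply immediately the following global inequalities |GJ|, |∇GJ|, |G∇*J|, |ΔGJ|, ‖∇GJ‖_α, ‖G∇*J‖_α ≦ O(1)|J|,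
(1.115)"*; [B5] Prop. 1.2 p. 35: *"There exists a positive constant δ₀ depending on d only, such that … with the constant O(1) depending
on d only"*.

THE INSTANCE (dictionary print ↦ Lean; the torus typing of `B8Eq158FlatTorus` / the B5 lineage).  Tori of record `i : TopIdx d L`
(`B5ResidualGpTorusHolds`): `T_η = Tor (fine n M)` with `n = nP i.P = L^K` fine steps per unit (`η = L^{−K}`, B8's `k = K ≥ 1`) and
`M_μ = MP i.P μ = 2L^m` unit cubes per direction, every `K ≥ 1`, `m ≥ 0`, `d ≥ 1`, `L` odd `> 1`; vector fields `A, J : T_η × Fin d → ℂ`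
(the ℂ-scalar model of the 𝔤-valued fields, as in all torus files); unit-lattice fields `B₁ : Tor M × Fin d → ℂ`.  U₀ = 1 and
Ω₀ = … = Ω_k = T_η (admissible), so Λ_j = ∅ (j < k), Λ_k = T^{(k)}, `L^kη = 1`, the sums over j in (1.58) have the single term j = k with
weight 1, and the p. 86 norms `|X|₍γ₎ = sup_{j ≤ k} sup_{Ω_j}(L^jη)^{−γ}|X|` are PLAIN SUPREMA for γ ≤ 0 (weights `(L^{j−k})^{|γ|} ≤ 1`,
`= 1` at j = k) — §5 proves this for `B8ScaledSupNorm.msup`.  G(1) = `B8Eq158FlatTorus.G8T n M 1 = (B5DeltaA169.DeltaA n M 1)⁻¹`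
(`G8T_one_eq`; a = (L^kη)⁻² = 1); Q_k* = `B5DeltaA169.QvAdj n M` (the η^{−d}-weighted adjoint of (1.18)); ∇^η_{U₀} at U₀ = 1 = all
forward differences ∂_νA_μ = `B5Prop11Lattice.grad n M` ((1.1) with R(U₀(b)) = 1); Δ^η_{U₀} at U₀ = 1 on vector fields =
D*D + DD* = ½CurlᴴCurl + ∂∂* = `B5Prop11Lower.Lap n M` (lattice Hodge identity `B5Action121.curl_adjoint_curl`, `lap_eq_hodge`);
D^{η*}D^η at U₀ = 1 on vector fields = `½·CurlOpᴴCurlOp` (as in `B8Eq158FlatTorus.P8T`); `|·|` = `LatticeNorms.supNorm univ` ((1.108) of [B5]).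

WHAT THIS MODULE PROVES (kernel-checked, 0 sorry; ONE constant B₀ = B₀(d, L) chosen BEFORE the torus, the volume and K — «depend on
d and L only»).
§1 `sup115_real` — [B5] (1.115), entries |GJ|, |∇GJ|, |ΔGJ|, read as GLOBAL POINTWISE bounds on T_η for real sources (from
`B5Prop12GHolds.global115_117_famG_printed` by name + the cube cover `B5GlobCoverP12Lattice.norm_le_of_cube_sups`), any a > 0.
§2 `sup347_flat` — the same for COMPLEX sources (ℂ-linearity and the splitting X = Re X + i·Im X, `norm_mulVec_le_of_real`; constant 2C):
«|GX|, |∇GX|, |ΔGX| ≦ B₀|X|» on every torus of record — [4] (3.47)/Thm 3.3 AT U = 1 (one level), hypothesis-free.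
§3 `norm_QvAdj_mulVec_le` — ‖Q_k*B‖_∞ ≦ ‖B‖_∞ (the rows of Q_k* = η^{−d}Q_kᴴ sum to 1: `B5Prop11G0Torus.qent_colsum`).
§4 **`ineq159_flat`** — (1.59) AT U₀ = 1: for every torus of record, every J, B₁ and A with (1.58) «A = G(1)J + G(1)Q_k*B₁»:
`|A|, |∇A|, |ΔA| ≦ B₀(|J| + |B₁|)`, and — under (1.55) «D*DA = J» — `|D*DA| ≦ B₀(|J| + |B₁|)` (B₀ ≥ 1; this member is (1.55) itself, the
reading of `B8FromB9.b8_159_DstarD_entry`); **`ineq159_flat_printed`** — the same four members from the PRINTED hypotheses of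
pp. 83–86, (1.55) «D*DA = J», (1.42) «R(U₀)D*A = 0», (1.56) «L^kηQ_kA = B₁», via (1.58) on the torus (`B8Eq158FlatTorus.eq158_line2_torus`,
no invertibility hypothesis at U₀ = 1).
§5 `msup_const_eq_supNorm` + **`ineq159_flat_weighted`** — the same in the PRINTED weighted norms `B8ScaledSupNorm.msup` ([4] (3.41)) over
the constant domain sequence (they are plain suprema for γ ≦ 0): `|A|₍₋₁₎, |∇A|₍₋₂₎, |ΔA|₍₋₃₎ (and |D*DA|₍₋₃₎ under (1.55)) ≦ B₀(|J|₍₋₃₎ + |B₁|)`.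

HONEST SCOPE.  (i) U₀ = 1 ONLY and the constant domain sequence ONLY (one surviving level): the general-background content of (1.59) is
[4] Theorem 3.3 (typed leaf `B9.Thm33Printed`, rows B9.Thm3.3 / B8.Eq1.59), NOT proved here; this is the «without external gauge field»
base case to which [4] p. 399 reduces its theorems.  (ii) The second line of (1.59) (the insertion of (1.55)–(1.56) into |J|₍₋₃₎ + |B₁|)
is bookkeeping already in the tree (`B8.apriori_160`, `B8FromB9.b8_159_printed_shape`) and is not repeated.  (iii) The D*D-member is
taken, as printed, for the A of (1.55) («D^{η*}_{U₀}D^η_{U₀}A = J»): for an arbitrary pair (J, B₁) the field A := G(J + Q*B₁) need not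
satisfy (1.55), so that member carries (1.55) as its hypothesis.  (iv) Constants: B₀ = max(1, 2·C₁₁₅(d, L, a = 1)) with C₁₁₅ the tree's
(1.115) constant (p37/r02/pv15 lineage; crude, ours); a = 1 because L^kη = 1 («if we put a = 1», [B5] Prop. 1.1).  (v) ℂ-scalar fields
(the abelian/scalar model typing of every torus file); 𝔤-valued = componentwise.  NOT restated: (1.115) itself, the Hodge identity, the
(1.58) identities of `B8Eq158FlatTorus` (all consumed by name).

VERSION v1.1 (r05 gen 18, append-only): §6 `apriori_160_flat` / `prop3_flat` — (1.60)–(1.62) = Proposition 3 at U₀ = 1 on top of §4 via the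
kernel-checked a-priori algebra `B8.apriori_160`/`B8.apriori_162`; declarations of v1.0 byte-identical.
-/

noncomputable section

open scoped BigOperators Matrix ComplexConjugate
open Finset Matrix

namespace Literature.MathematicalPhysics.QuantumFieldTheory.Balaban1983to89.B8Ineq159FlatTorus

open B5Prop11Plancherel (Tor fine)
open B5Action121 (CurlOp GradOp LapV curl_adjoint_curl Lap_eq_LapV)
open B5Block118 (QvOp)
open B5DeltaA169 (QvAdj DeltaA)
open B5Prop11Lattice (grad)
open B5Prop11Lower (Lap)
open LatticeNorms (supNorm norm_le_supNorm supNorm_le supNorm_nonneg supNorm_add_le)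
open B5Prop12FieldsLattice (cubeB eL supNormL eL_zero_vec eL_one_vec eL_three_vec)
open B5SettingP12Real (LocR latticeSettingP12R)
open B5Prop12GLattice (famG)
open B5Prop12GHolds (global115_117_famG_printed)
open B5SiteBridgeP12 (nP MP one_le_nP)
open B5ResidualGpTorusHolds (TopIdx)
open B5RealFields (cplx cplx_apply)
open B5Prop11G0Torus (qent QvOp_eq_qent qent_colsum)
open B5GlobCoverP12Lattice (norm_le_of_cube_sups norm_le_of_cube_sups_flat)
open B8Eq158FlatTorus (P8T G8T P8T_eq_DeltaA eq158_line2_torus)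
open B5Identities197Torus (RT)
open B5Prop11Plancherel (fdiff)
open B8ScaledSupNorm (msup weight Bdd msup_le bdd_of_forall weight_mul_norm_le_msup weight_nonneg)

variable {d : ℕ}

/-! ## §0 Dictionary: G(1), Δ at U₀ = 1 -/

section Dictionary

variable (n : ℕ) [NeZero n] (M : Fin d → ℕ) [hM : ∀ μ, NeZero (M μ)]

/-- **G(U₀) of (1.58) at U₀ = 1, one level, `L^kη = 1`: `G(1) = Δ_a⁻¹` with `a = 1`** (`B8Eq158FlatTorus.G8T n M 1 = (DeltaA n M 1)⁻¹`).
[cite: Balaban1985RegularSpaces, (1.58) p.86; Balaban1984PropagatorsI, (1.71) p.30] -/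
theorem G8T_one_eq : G8T n M 1 = (DeltaA n M 1)⁻¹ := by
  rw [G8T, P8T_eq_DeltaA]
  norm_num

/-- **The lattice Hodge identity at U₀ = 1**: B8's `Δ^η_{U₀} = D^{η*}D^η + D^ηD^{η*}` on vector fields at the trivial background,
`½·CurlᴴCurl + ∂∂ᴴ`, IS the componentwise Laplacian `Δ = Σ_ν∇_ν*∇_ν` of [B5] (1.21) (`B5Prop11Lower.Lap`) — `B5Action121.curl_adjoint_curl`.
[cite: Balaban1985RegularSpaces, (1.39) p.83 (Δ^η_{U₀}), (1.1)–(1.2) p.76; Balaban1984PropagatorsI, (1.21) p.21] -/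
theorem lap_eq_hodge :
    Lap n M = (1 / 2 : ℂ) • ((CurlOp (fine n M) (n : ℂ))ᴴ * CurlOp (fine n M) (n : ℂ))
      + GradOp (fine n M) (n : ℂ) * (GradOp (fine n M) (n : ℂ))ᴴ := by
  rw [curl_adjoint_curl, smul_smul, Lap_eq_LapV]
  norm_num

end Dictionary

/-! ## §1 [B5] (1.115) — entries |GJ|, |∇GJ|, |ΔGJ| — as global pointwise bounds on the tori of record (real sources) -/

section Real115

variable {L : ℕ}

/-- **[B5] (1.115), three sup entries, HYPOTHESIS-FREE on the torus family of record** (`B5Prop12GHolds.global115_117_famG_printed` by name):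
ONE constant `C = C(d, L, a) > 0` such that for every torus of record `i` (η = L^{−K}, K ≥ 1, any volume) and every REAL vector source `v`,
at every bond `b` and direction `ν`: `|(Gv)(b)| ≦ C|v|`, `|(∇_νGv)(b)| ≦ C|v|`, `|(ΔGv)(b)| ≦ C|v|`, `G = Δ_a⁻¹`.
[cite: Balaban1984PropagatorsI, (1.115) p.36, Prop. 1.2 (1.110) p.35] -/
theorem sup115_real (hd : 1 ≤ d) (hL : Odd L ∧ 1 < L) {a : ℝ} (ha : 0 < a) :
    ∃ C : ℝ, 0 < C ∧ ∀ (i : TopIdx d L) (v : Tor (fine (nP i.P) (MP i.P)) × Fin i.P.d → ℝ),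
      (∀ b, ‖((DeltaA (nP i.P) (MP i.P) a)⁻¹ *ᵥ cplx v) b‖ ≤ C * supNorm univ (cplx v)) ∧
      (∀ ν b, ‖grad (nP i.P) (MP i.P) ((DeltaA (nP i.P) (MP i.P) a)⁻¹ *ᵥ cplx v) ν b‖ ≤ C * supNorm univ (cplx v)) ∧
      (∀ b, ‖(Lap (nP i.P) (MP i.P) *ᵥ ((DeltaA (nP i.P) (MP i.P) a)⁻¹ *ᵥ cplx v)) b‖ ≤ C * supNorm univ (cplx v)) := by
  obtain ⟨C, Cα, Cε, Cαε, hC, h⟩ := global115_117_famG_printed hd hL ha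
  refine ⟨C, hC, fun i v => ?_⟩
  have h115 := (h i).1
  -- the (1.115) entries m = 0, 1, 3 at the real vector source `v`, unfolded to the torus quantities
  have h0 : ∀ y : Tor (MP i.P), supNorm (cubeB (nP i.P) (MP i.P) y) ((DeltaA (nP i.P) (MP i.P) a)⁻¹ *ᵥ cplx v)
      ≤ C * supNorm univ (cplx v) := fun y => by
    have := h115 0 (LocR.vec v) y
    exact this
  have h1 : ∀ y : Tor (MP i.P), supNorm (Finset.univ ×ˢ cubeB (nP i.P) (MP i.P) y)
      (fun p : Fin i.P.d × (Tor (fine (nP i.P) (MP i.P)) × Fin i.P.d) =>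
        grad (nP i.P) (MP i.P) ((DeltaA (nP i.P) (MP i.P) a)⁻¹ *ᵥ cplx v) p.1 p.2) ≤ C * supNorm univ (cplx v) := fun y => by
    have := h115 1 (LocR.vec v) y
    exact this
  have h3 : ∀ y : Tor (MP i.P), supNorm (cubeB (nP i.P) (MP i.P) y)
      (Lap (nP i.P) (MP i.P) *ᵥ ((DeltaA (nP i.P) (MP i.P) a)⁻¹ *ᵥ cplx v)) ≤ C * supNorm univ (cplx v) := fun y => by
    have := h115 3 (LocR.vec v) y
    exact this
  refine ⟨fun b => norm_le_of_cube_sups (MP i.P) (nP i.P) _ h0 b, fun ν b => ?_, fun b => norm_le_of_cube_sups (MP i.P) (nP i.P) _ h3 b⟩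
  exact norm_le_of_cube_sups_flat (MP i.P) (nP i.P) _ h1 (ν, b)

end Real115

/-! ## §2 Complex sources: [4] (3.47)/Theorem 3.3 at U = 1, one level, hypothesis-free -/

section Complexify

variable {m m' : Type*}

/-- `X = Re X + i·Im X` for a complex field. [folklore] -/
private theorem re_add_im_decomp (X : m → ℂ) :
    X = cplx (fun b => (X b).re) + Complex.I • cplx (fun b => (X b).im) := by
  funext b
  simp only [Pi.add_apply, Pi.smul_apply, cplx_apply, smul_eq_mul]
  rw [mul_comm, Complex.re_add_im]

variable [Fintype m]

/-- `|Re X| ≦ |X|`. [folklore] -/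
private theorem supNorm_re_le (X : m → ℂ) : supNorm univ (cplx fun b => (X b).re) ≤ supNorm univ X :=
  supNorm_le (supNorm_nonneg _ _) fun b hb => by
    rw [cplx_apply, Complex.norm_real, Real.norm_eq_abs]
    exact (Complex.abs_re_le_norm _).trans (norm_le_supNorm X hb)

/-- `|Im X| ≦ |X|`. [folklore] -/
private theorem supNorm_im_le (X : m → ℂ) : supNorm univ (cplx fun b => (X b).im) ≤ supNorm univ X :=
  supNorm_le (supNorm_nonneg _ _) fun b hb => by
    rw [cplx_apply, Complex.norm_real, Real.norm_eq_abs]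
    exact (Complex.abs_im_le_norm _).trans (norm_le_supNorm X hb)

/-- **Real operators, complex sources**: a pointwise sup bound `|(Tv)(b)| ≦ C|v|` for REAL sources `v` gives
`|(TX)(b)| ≦ 2C|X|` for complex `X` (splitting `X = Re X + i Im X`; the device by which [B5]'s real-field (1.115) serves the
ℂ-scalar typing of the torus files). [folklore] -/
private theorem norm_mulVec_le_of_real (T : Matrix m' m ℂ) {C : ℝ} (hC : 0 ≤ C)
    (h : ∀ (v : m → ℝ) (b : m'), ‖(T *ᵥ cplx v) b‖ ≤ C * supNorm univ (cplx v)) (X : m → ℂ) (b : m') :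
    ‖(T *ᵥ X) b‖ ≤ 2 * C * supNorm univ X := by
  have hre := (h (fun b => (X b).re) b).trans (mul_le_mul_of_nonneg_left (supNorm_re_le X) hC)
  have him := (h (fun b => (X b).im) b).trans (mul_le_mul_of_nonneg_left (supNorm_im_le X) hC)
  have hX : T *ᵥ X = T *ᵥ cplx (fun b => (X b).re) + Complex.I • (T *ᵥ cplx fun b => (X b).im) := by
    conv_lhs => rw [re_add_im_decomp X]
    rw [Matrix.mulVec_add, Matrix.mulVec_smul]
  rw [hX, Pi.add_apply, Pi.smul_apply, smul_eq_mul]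
  calc ‖(T *ᵥ cplx fun b => (X b).re) b + Complex.I * (T *ᵥ cplx fun b => (X b).im) b‖
      ≤ ‖(T *ᵥ cplx fun b => (X b).re) b‖ + ‖Complex.I * (T *ᵥ cplx fun b => (X b).im) b‖ := norm_add_le _ _
    _ = ‖(T *ᵥ cplx fun b => (X b).re) b‖ + ‖(T *ᵥ cplx fun b => (X b).im) b‖ := by
        rw [norm_mul, Complex.norm_I, one_mul]
    _ ≤ C * supNorm univ X + C * supNorm univ X := add_le_add hre him
    _ = 2 * C * supNorm univ X := by ring

end Complexify

section Flat347

variable {L : ℕ}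

/-- **[4] (3.47) / Theorem 3.3 AT U = 1 (one level, a > 0), HYPOTHESIS-FREE on the tori of record**: ONE constant
`C = C(d, L, a) > 0` with `|GX|, |∇GX|, |ΔGX| ≦ C|X|` pointwise on `T_η` for EVERY complex vector source `X`, `G = Δ_a⁻¹` — the
«propagators without external gauge field» case to which [4] p. 399 reduces Theorems 3.1–3.3, here = [B5] (1.115) (§1) complexified (§2).
[cite: Balaban1985BackgroundPropagators, (3.47) p.398, Thm 3.3 p.399; Balaban1984PropagatorsI, (1.115) p.36] -/
theorem sup347_flat (hd : 1 ≤ d) (hL : Odd L ∧ 1 < L) {a : ℝ} (ha : 0 < a) :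
    ∃ C : ℝ, 0 < C ∧ ∀ (i : TopIdx d L) (X : Tor (fine (nP i.P) (MP i.P)) × Fin i.P.d → ℂ),
      (∀ b, ‖((DeltaA (nP i.P) (MP i.P) a)⁻¹ *ᵥ X) b‖ ≤ C * supNorm univ X) ∧
      (∀ ν b, ‖grad (nP i.P) (MP i.P) ((DeltaA (nP i.P) (MP i.P) a)⁻¹ *ᵥ X) ν b‖ ≤ C * supNorm univ X) ∧
      (∀ b, ‖(Lap (nP i.P) (MP i.P) *ᵥ ((DeltaA (nP i.P) (MP i.P) a)⁻¹ *ᵥ X)) b‖ ≤ C * supNorm univ X) := by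
  obtain ⟨C, hC, h⟩ := sup115_real hd hL ha
  refine ⟨2 * C, by positivity, fun i X => ?_⟩
  refine ⟨fun b => norm_mulVec_le_of_real _ hC.le (fun v b => (h i v).1 b) X b, fun ν b => ?_, fun b => ?_⟩
  · -- `∇_ν(GX) = (∇_ν·G)X`
    have e : ∀ Y : Tor (fine (nP i.P) (MP i.P)) × Fin i.P.d → ℂ,
        grad (nP i.P) (MP i.P) ((DeltaA (nP i.P) (MP i.P) a)⁻¹ *ᵥ Y) ν
          = (fdiff (fine (nP i.P) (MP i.P)) ((nP i.P : ℕ) : ℂ) ν * (DeltaA (nP i.P) (MP i.P) a)⁻¹) *ᵥ Y := fun Y => by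
      rw [← Matrix.mulVec_mulVec]; rfl
    rw [e]
    exact norm_mulVec_le_of_real _ hC.le (fun v b => by rw [← e]; exact (h i v).2.1 ν b) X b
  · rw [Matrix.mulVec_mulVec]
    exact norm_mulVec_le_of_real _ hC.le (fun v b => by rw [← Matrix.mulVec_mulVec]; exact (h i v).2.2 b) X b

end Flat347

/-! ## §3 The averaging adjoint `Q_k*`: ‖Q_k*B‖_∞ ≦ ‖B‖_∞ -/

section QAdj

variable (n : ℕ) [NeZero n] (M : Fin d → ℕ) [hM : ∀ μ, NeZero (M μ)]

omit [NeZero n] hM in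
/-- `q(b; i) ≥ 0` (the entries (1.18) are `η^{d+1}`-multiples of counting numbers). [cite: Balaban1984PropagatorsI, (1.18) p.20] -/
private theorem qent_nonneg' (b : Tor M × Fin d) (i : Tor (fine n M) × Fin d) : 0 ≤ qent n M b i := by
  unfold qent
  split_ifs
  · exact Finset.sum_nonneg fun _ _ => Finset.sum_nonneg fun _ _ => by positivity
  · exact le_rfl

omit [NeZero n] hM in
/-- the entries of `Q_k* = η^{−d}Q_kᴴ` are the non-negative reals `η^{−d}q(b; i)`. [cite: Balaban1984PropagatorsI, (1.18) p.20, (1.21) p.21] -/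
theorem QvAdj_apply (i : Tor (fine n M) × Fin d) (b : Tor M × Fin d) :
    QvAdj n M i b = (((n : ℝ) ^ d * qent n M b i : ℝ) : ℂ) := by
  simp only [QvAdj, Matrix.smul_apply, Matrix.conjTranspose_apply, QvOp_eq_qent, Complex.star_def,
    Complex.conj_ofReal, smul_eq_mul]
  push_cast
  ring

omit [NeZero n] hM in
/-- `|Q_k*(i; b)| = η^{−d}q(b; i)`. [cite: Balaban1984PropagatorsI, (1.18) p.20] -/
theorem norm_QvAdj_apply (i : Tor (fine n M) × Fin d) (b : Tor M × Fin d) :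
    ‖QvAdj n M i b‖ = (n : ℝ) ^ d * qent n M b i := by
  rw [QvAdj_apply, Complex.norm_real, Real.norm_of_nonneg (mul_nonneg (by positivity) (qent_nonneg' n M b i))]

/-- **the rows of `Q_k*` have ℓ¹-mass one**: `Σ_b |Q_k*(i; b)| = η^{−d}·Σ_b q(b; i) = 1` (`B5Prop11G0Torus.qent_colsum`: every fine
bond lies on exactly `n` averaging segments of weight `η^{d+1}`). [cite: Balaban1984PropagatorsI, (1.18) p.20] -/
theorem sum_norm_QvAdj (i : Tor (fine n M) × Fin d) : ∑ b, ‖QvAdj n M i b‖ = 1 := by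
  simp_rw [norm_QvAdj_apply]
  rw [← Finset.mul_sum, qent_colsum]
  have hn : (n : ℝ) ≠ 0 := Nat.cast_ne_zero.mpr (NeZero.ne n)
  field_simp

/-- **`|Q_k*B₁| ≦ |B₁|`**: the level-k source term of (1.58) is bounded by the unit-lattice datum (row mass one). This is the
reason `|B₁|` enters (1.59) UNWEIGHTED. [cite: Balaban1985RegularSpaces, (1.58)–(1.59) p.86; Balaban1984PropagatorsI, (1.18) p.20] -/
theorem norm_QvAdj_mulVec_le (B : Tor M × Fin d → ℂ) (i : Tor (fine n M) × Fin d) :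
    ‖(QvAdj n M *ᵥ B) i‖ ≤ supNorm univ B := by
  calc ‖(QvAdj n M *ᵥ B) i‖ = ‖∑ b, QvAdj n M i b * B b‖ := rfl
    _ ≤ ∑ b, ‖QvAdj n M i b * B b‖ := norm_sum_le _ _
    _ = ∑ b, ‖QvAdj n M i b‖ * ‖B b‖ := by simp_rw [norm_mul]
    _ ≤ ∑ b, ‖QvAdj n M i b‖ * supNorm univ B :=
        Finset.sum_le_sum fun b _ => mul_le_mul_of_nonneg_left (norm_le_supNorm B (Finset.mem_univ b)) (norm_nonneg _)
    _ = supNorm univ B := by rw [← Finset.sum_mul, sum_norm_QvAdj, one_mul]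

/-- `|J + Q_k*B₁| ≦ |J| + |B₁|` — the source of (1.58) at one level. [cite: Balaban1985RegularSpaces, (1.58)–(1.59) p.86] -/
theorem supNorm_source_le (J : Tor (fine n M) × Fin d → ℂ) (B : Tor M × Fin d → ℂ) :
    supNorm univ (J + QvAdj n M *ᵥ B) ≤ supNorm univ J + supNorm univ B := by
  have h1 : supNorm univ (QvAdj n M *ᵥ B) ≤ supNorm univ B :=
    supNorm_le (supNorm_nonneg _ _) fun i _ => norm_QvAdj_mulVec_le n M B i
  have h2 := supNorm_add_le univ J (QvAdj n M *ᵥ B)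
  linarith

end QAdj

/-! ## §4 (1.59) at U₀ = 1 for the constant domain sequence -/

section Ineq159

variable {L : ℕ}

/-- **(1.59) p. 86 AT THE FLAT BACKGROUND, plain-sup form, HYPOTHESIS-FREE**: there is ONE constant `B₀ = B₀(d, L) ≥ 1` such that on
EVERY torus of record `i` (η = L^{−K}, K ≥ 1, any volume 2L^m), for every bond source `J`, unit-lattice datum `B₁` and every `A` given by
(1.58) at U₀ = 1, one level, `A = G(1)J + G(1)Q_k*B₁`:  `|A(b)|, |(∇_νA)(b)|, |(ΔA)(b)| ≦ B₀(|J| + |B₁|)` at every bond `b`, direction `ν`;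
and, if A is the configuration of (1.55) («D^{η*}D^ηA = J»), also `|(D*DA)(b)| ≦ B₀(|J| + |B₁|)`.  Members: A, ∇^η_{U₀}A = `grad`, Δ^η_{U₀}A =
`Lap *ᵥ A` (`lap_eq_hodge`), D^{η*}D^ηA = `½·Curlᴴ(Curl A)`; G(1) = `G8T _ _ 1` (`G8T_one_eq`).
[cite: Balaban1985RegularSpaces, (1.59) p.86, Prop. 3 p.87 («B₀ … depend on d and L only»); Balaban1985BackgroundPropagators, Thm 3.3 p.399;
Balaban1984PropagatorsI, (1.115) p.36] -/
theorem ineq159_flat (hd : 1 ≤ d) (hL : Odd L ∧ 1 < L) :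
    ∃ B₀ : ℝ, 1 ≤ B₀ ∧ ∀ (i : TopIdx d L) (J A : Tor (fine (nP i.P) (MP i.P)) × Fin i.P.d → ℂ)
      (B₁ : Tor (MP i.P) × Fin i.P.d → ℂ),
      A = G8T (nP i.P) (MP i.P) 1 *ᵥ J + G8T (nP i.P) (MP i.P) 1 *ᵥ (QvAdj (nP i.P) (MP i.P) *ᵥ B₁) →
      (∀ b, ‖A b‖ ≤ B₀ * (supNorm univ J + supNorm univ B₁)) ∧
      (∀ ν b, ‖grad (nP i.P) (MP i.P) A ν b‖ ≤ B₀ * (supNorm univ J + supNorm univ B₁)) ∧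
      (∀ b, ‖(Lap (nP i.P) (MP i.P) *ᵥ A) b‖ ≤ B₀ * (supNorm univ J + supNorm univ B₁)) ∧
      ((1 / 2 : ℂ) • ((CurlOp (fine (nP i.P) (MP i.P)) ((nP i.P : ℕ) : ℂ))ᴴ *ᵥ
          (CurlOp (fine (nP i.P) (MP i.P)) ((nP i.P : ℕ) : ℂ) *ᵥ A)) = J →
        ∀ b, ‖((1 / 2 : ℂ) • ((CurlOp (fine (nP i.P) (MP i.P)) ((nP i.P : ℕ) : ℂ))ᴴ *ᵥ
          (CurlOp (fine (nP i.P) (MP i.P)) ((nP i.P : ℕ) : ℂ) *ᵥ A))) b‖ ≤ B₀ * (supNorm univ J + supNorm univ B₁)) := by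
  obtain ⟨C, hC, h⟩ := sup347_flat hd hL one_pos
  refine ⟨max 1 C, le_max_left _ _, fun i J A B₁ hA => ?_⟩
  -- the source of (1.58) and its size
  set X : Tor (fine (nP i.P) (MP i.P)) × Fin i.P.d → ℂ := J + QvAdj (nP i.P) (MP i.P) *ᵥ B₁ with hXdef
  have hXle : supNorm univ X ≤ supNorm univ J + supNorm univ B₁ := supNorm_source_le _ _ J B₁
  have hJle : supNorm univ J ≤ supNorm univ J + supNorm univ B₁ := le_add_of_nonneg_right (supNorm_nonneg _ _)
  have hsum : 0 ≤ supNorm univ J + supNorm univ B₁ := add_nonneg (supNorm_nonneg _ _) (supNorm_nonneg _ _)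
  have hCB : C * supNorm univ X ≤ max 1 C * (supNorm univ J + supNorm univ B₁) :=
    mul_le_mul (le_max_right _ _) hXle (supNorm_nonneg _ _) (le_trans zero_le_one (le_max_left _ _))
  -- A = G(1)X with G(1) = Δ₁⁻¹
  have hA' : A = (DeltaA (nP i.P) (MP i.P) 1)⁻¹ *ᵥ X := by
    rw [hA, ← Matrix.mulVec_add, G8T_one_eq]
  obtain ⟨h0, h1, h3⟩ := h i X
  refine ⟨fun b => ?_, fun ν b => ?_, fun b => ?_, fun h55 b => ?_⟩
  · rw [hA']; exact (h0 b).trans hCB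
  · rw [hA']; exact (h1 ν b).trans hCB
  · rw [hA']; exact (h3 b).trans hCB
  · rw [h55]
    exact ((norm_le_supNorm J (Finset.mem_univ b)).trans hJle).trans
      (le_mul_of_one_le_left hsum (le_max_left _ _))

/-- **(1.59) from the printed hypotheses of pp. 85–86** — (1.55) «D^{η*}_{U₀}D^η_{U₀}A = J», (1.42) «R(U₀)D^{η*}_{U₀}A = 0» and (1.56)
«L^kηQ_kA = B₁» (here L^kη = 1) — at U₀ = 1 on every torus of record: then (1.58) holds (`B8Eq158FlatTorus.eq158_line2_torus`, no
invertibility hypothesis) and ALL FOUR members obey `|A|, |∇A|, |D*DA|, |ΔA| ≦ B₀(|J| + |B₁|)` with the B₀(d, L) of `ineq159_flat`.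
[cite: Balaban1985RegularSpaces, (1.55)–(1.59) p.86, (1.42) p.83] -/
theorem ineq159_flat_printed (hd : 1 ≤ d) (hL : Odd L ∧ 1 < L) :
    ∃ B₀ : ℝ, 1 ≤ B₀ ∧ ∀ (i : TopIdx d L) (J A : Tor (fine (nP i.P) (MP i.P)) × Fin i.P.d → ℂ)
      (B₁ : Tor (MP i.P) × Fin i.P.d → ℂ),
      (1 / 2 : ℂ) • ((CurlOp (fine (nP i.P) (MP i.P)) ((nP i.P : ℕ) : ℂ))ᴴ *ᵥ
          (CurlOp (fine (nP i.P) (MP i.P)) ((nP i.P : ℕ) : ℂ) *ᵥ A)) = J →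
      RT (nP i.P) (MP i.P) *ᵥ ((GradOp (fine (nP i.P) (MP i.P)) ((nP i.P : ℕ) : ℂ))ᴴ *ᵥ A) = 0 →
      QvOp (nP i.P) (MP i.P) *ᵥ A = B₁ →
      (∀ b, ‖A b‖ ≤ B₀ * (supNorm univ J + supNorm univ B₁)) ∧
      (∀ ν b, ‖grad (nP i.P) (MP i.P) A ν b‖ ≤ B₀ * (supNorm univ J + supNorm univ B₁)) ∧
      (∀ b, ‖((1 / 2 : ℂ) • ((CurlOp (fine (nP i.P) (MP i.P)) ((nP i.P : ℕ) : ℂ))ᴴ *ᵥ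
          (CurlOp (fine (nP i.P) (MP i.P)) ((nP i.P : ℕ) : ℂ) *ᵥ A))) b‖ ≤ B₀ * (supNorm univ J + supNorm univ B₁)) ∧
      (∀ b, ‖(Lap (nP i.P) (MP i.P) *ᵥ A) b‖ ≤ B₀ * (supNorm univ J + supNorm univ B₁)) := by
  obtain ⟨B₀, hB₀, h⟩ := ineq159_flat hd hL
  refine ⟨B₀, hB₀, fun i J A B₁ h55 h42 h56 => ?_⟩
  have h56' : ((1 : ℝ) : ℂ) • (QvOp (nP i.P) (MP i.P) *ᵥ A) = B₁ := by rw [Complex.ofReal_one, one_smul, h56]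
  have h58 := eq158_line2_torus (nP i.P) (MP i.P) (one_le_nP i.P) one_pos h55 h42 h56'
  simp only [inv_one, one_pow, Complex.ofReal_one, one_smul] at h58
  obtain ⟨hAb, hgr, hlap, hdd⟩ := h i J A B₁ h58
  exact ⟨hAb, hgr, hdd h55, hlap⟩

end Ineq159

/-! ## §5 The printed weighted norms `| |₍γ₎` over the constant domain sequence are plain suprema (γ ≦ 0) -/

section Weighted

variable {ι : Type*} [Fintype ι] {E : Type*} [SeminormedAddCommGroup E]

/-- For the constant domain sequence `Ω₀ = … = Ω_k = T_η` (membership ≡ `True`), `η = L^{−k}`, `L ≥ 1` and an exponent `γ ≦ 0`, the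
p. 86 norm `|F|₍γ₎ = sup_{j ≤ k} sup_{Ω_j}(L^jη)^{−γ}|F|` IS the plain supremum `|F|`: the weights `(L^{j−k})^{|γ|}` are `≦ 1` and `= 1`
at `j = k`. [cite: Balaban1985RegularSpaces, p.86 (definition after (1.55))] -/
theorem msup_const_eq_supNorm {L k : ℕ} (hL : 1 ≤ L) {γ : ℝ} (hγ : γ ≤ 0) (F : ι → E) :
    msup L k (((L : ℝ) ^ k)⁻¹) γ (fun _ _ => True) F = supNorm univ F := by
  have hLr : (1 : ℝ) ≤ L := by exact_mod_cast hL
  have hLk : 0 < (L : ℝ) ^ k := pow_pos (by positivity) k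
  have hη : 0 < ((L : ℝ) ^ k)⁻¹ := inv_pos.mpr hLk
  -- weights ≤ 1, and = 1 at the top level
  have hw : ∀ j ≤ k, weight L (((L : ℝ) ^ k)⁻¹) γ j ≤ 1 := fun j hj => by
    unfold weight
    refine Real.rpow_le_one (mul_nonneg (pow_nonneg (by positivity) j) hη.le) ?_ (neg_nonneg.mpr hγ)
    rw [← div_eq_mul_inv, div_le_one hLk]
    exact pow_le_pow_right₀ hLr hj
  have hwk : weight L (((L : ℝ) ^ k)⁻¹) γ k = 1 := by
    unfold weight
    rw [mul_inv_cancel₀ hLk.ne', Real.one_rpow]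
  have hB : Bdd L k (((L : ℝ) ^ k)⁻¹) γ (fun _ _ => True) F :=
    bdd_of_forall (c := supNorm univ F) fun j hj i _ =>
      (mul_le_mul_of_nonneg_right (hw j hj) (norm_nonneg _)).trans
        (by rw [one_mul]; exact norm_le_supNorm F (Finset.mem_univ i))
  refine le_antisymm (msup_le (supNorm_nonneg _ _) fun j hj i _ => ?_) (supNorm_le ?_ fun i _ => ?_)
  · exact (mul_le_mul_of_nonneg_right (hw j hj) (norm_nonneg _)).trans
      (by rw [one_mul]; exact norm_le_supNorm F (Finset.mem_univ i))
  · exact B8ScaledSupNorm.msup_nonneg L k hη.le γ _ F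
  · have := weight_mul_norm_le_msup hB le_rfl (i := i) trivial
    rwa [hwk, one_mul] at this

variable {L : ℕ}

/-- **(1.59) p. 86 AT U₀ = 1 IN THE PRINTED NORMS** `| |₍γ₎` of p. 86 / [4] (3.41) (`B8ScaledSupNorm.msup`, levels `j ≤ k = K`, `η = L^{−K}`,
constant domain sequence): `|A|₍₋₁₎, |∇^η_{U₀}A|₍₋₂₎, |Δ^η_{U₀}A|₍₋₃₎ ≦ B₀(|J|₍₋₃₎ + |B₁|)` for `A = G(1)J + G(1)Q_k*B₁`, and
`|D^{η*}_{U₀}D^η_{U₀}A|₍₋₃₎ ≦ B₀(|J|₍₋₃₎ + |B₁|)` under (1.55), with the B₀(d, L) ≥ 1 of `ineq159_flat`.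
[cite: Balaban1985RegularSpaces, (1.59) p.86; Balaban1985BackgroundPropagators, (3.41) p.397, Thm 3.3 p.399] -/
theorem ineq159_flat_weighted (hd : 1 ≤ d) (hL : Odd L ∧ 1 < L) :
    ∃ B₀ : ℝ, 1 ≤ B₀ ∧ ∀ (i : TopIdx d L) (J A : Tor (fine (nP i.P) (MP i.P)) × Fin i.P.d → ℂ)
      (B₁ : Tor (MP i.P) × Fin i.P.d → ℂ),
      A = G8T (nP i.P) (MP i.P) 1 *ᵥ J + G8T (nP i.P) (MP i.P) 1 *ᵥ (QvAdj (nP i.P) (MP i.P) *ᵥ B₁) →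
      msup L i.P.K (((L : ℝ) ^ i.P.K)⁻¹) (-1) (fun _ _ => True) A
          ≤ B₀ * (msup L i.P.K (((L : ℝ) ^ i.P.K)⁻¹) (-3) (fun _ _ => True) J + supNorm univ B₁) ∧
      msup L i.P.K (((L : ℝ) ^ i.P.K)⁻¹) (-2) (fun _ _ => True)
          (fun p : Fin i.P.d × (Tor (fine (nP i.P) (MP i.P)) × Fin i.P.d) => grad (nP i.P) (MP i.P) A p.1 p.2)
          ≤ B₀ * (msup L i.P.K (((L : ℝ) ^ i.P.K)⁻¹) (-3) (fun _ _ => True) J + supNorm univ B₁) ∧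
      msup L i.P.K (((L : ℝ) ^ i.P.K)⁻¹) (-3) (fun _ _ => True) (Lap (nP i.P) (MP i.P) *ᵥ A)
          ≤ B₀ * (msup L i.P.K (((L : ℝ) ^ i.P.K)⁻¹) (-3) (fun _ _ => True) J + supNorm univ B₁) ∧
      ((1 / 2 : ℂ) • ((CurlOp (fine (nP i.P) (MP i.P)) ((nP i.P : ℕ) : ℂ))ᴴ *ᵥ
          (CurlOp (fine (nP i.P) (MP i.P)) ((nP i.P : ℕ) : ℂ) *ᵥ A)) = J →
        msup L i.P.K (((L : ℝ) ^ i.P.K)⁻¹) (-3) (fun _ _ => True)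
            ((1 / 2 : ℂ) • ((CurlOp (fine (nP i.P) (MP i.P)) ((nP i.P : ℕ) : ℂ))ᴴ *ᵥ
              (CurlOp (fine (nP i.P) (MP i.P)) ((nP i.P : ℕ) : ℂ) *ᵥ A)))
          ≤ B₀ * (msup L i.P.K (((L : ℝ) ^ i.P.K)⁻¹) (-3) (fun _ _ => True) J + supNorm univ B₁)) := by
  obtain ⟨B₀, hB₀, h⟩ := ineq159_flat hd hL
  have hL1 : 1 ≤ L := hL.2.le
  refine ⟨B₀, hB₀, fun i J A B₁ hA => ?_⟩
  obtain ⟨hAb, hgr, hlap, hdd⟩ := h i J A B₁ hA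
  have hsum : 0 ≤ B₀ * (supNorm univ J + supNorm univ B₁) :=
    mul_nonneg (zero_le_one.trans hB₀) (add_nonneg (supNorm_nonneg _ _) (supNorm_nonneg _ _))
  rw [msup_const_eq_supNorm hL1 (by norm_num) J, msup_const_eq_supNorm hL1 (by norm_num) A,
    msup_const_eq_supNorm hL1 (by norm_num), msup_const_eq_supNorm hL1 (by norm_num) (Lap _ _ *ᵥ A)]
  refine ⟨supNorm_le hsum fun b _ => hAb b, supNorm_le hsum fun p _ => hgr p.1 p.2, supNorm_le hsum fun b _ => hlap b,
    fun h55 => ?_⟩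
  rw [msup_const_eq_supNorm hL1 (by norm_num)]
  exact supNorm_le hsum fun b _ => hdd h55 b

end Weighted

/-! ## §6 (v1.1, r05 gen 18) (1.60)–(1.62) / Proposition 3 AT U₀ = 1: the printed a-priori algebra of pp. 86–87
(`B8.apriori_160`, `B8.apriori_162`, kernel-checked in `B8.lean`) ON TOP OF §4 — the flat instance of Proposition 3 -/

section Prop3Flat

variable {L : ℕ}

/-- **(1.60) AT THE FLAT BACKGROUND U₀ = 1** (constant domain sequence, every torus of record; p. 86, verbatim: *"Let us take this bound
for |∇^η_{U₀}A|₍₋₂₎ on the left-hand side, and let us assume that B₀36dα₂ ≦ 1/2. This gives us a bound for |∇^η_{U₀}A|₍₋₂₎, equal to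
the right-hand side above without this term and multiplied by 2. Using this bound we get |A|₍₋₁₎, |∇^η_{U₀}A|₍₋₂₎,
|D^{η*}_{U₀}D^η_{U₀}A|₍₋₃₎, |Δ^η_{U₀}A|₍₋₃₎ < B₀(4α₀ + 4dLα₁ + 2α₂² + 20dα₀α₂ + 2C₂α₂²). (1.60)"*): with the B₀(d, L) ≥ 1 of
`ineq159_flat`, for every A with (1.55) «D^{η*}_{U₀}D^η_{U₀}A = J», (1.42) «R(U₀)D^{η*}_{U₀}A = 0», (1.56) «L^jηQ_jA = B₁» (L^kη = 1) whose
sources obey the PRINTED sizes — the second line of (1.55) «|J|₍₋₃₎ ≦ 2α₀ + 36dα₂|∇^η_{U₀}A|₍₋₂₎ + 50dα₂³ + 10dα₀α₂» and the line after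
(1.56) «|B₁| < 2dLα₁ + C₂α₂²» (here with ≦) — and the p. 86 side condition 36dB₀α₂ ≦ ½ (+ the harmless 50dα₂ ≦ 1 of `B8.apriori_160`),
ALL FOUR members obey (1.60) pointwise (the weighted norms are plain suprema here, §5 `msup_const_eq_supNorm`).  Scope: U₀ = 1 and
one level only (as §4); the (1.43)–(1.55) derivation of the |J|-line from (1.40)–(1.41) is NOT repeated (rows B8.Eq1.43–B8.Eq1.55,
proved-existing) — that line enters as the printed hypothesis, exactly as in `B8.apriori_160`.
[cite: Balaban1985RegularSpaces, (1.55)–(1.60) p.86, (1.42) p.83] -/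
theorem apriori_160_flat (hd : 1 ≤ d) (hL : Odd L ∧ 1 < L) :
    ∃ B₀ : ℝ, 1 ≤ B₀ ∧ ∀ (i : TopIdx d L) (J A : Tor (fine (nP i.P) (MP i.P)) × Fin i.P.d → ℂ)
      (B₁ : Tor (MP i.P) × Fin i.P.d → ℂ) (α₀ α₁ α₂ C₂ : ℝ),
      (1 / 2 : ℂ) • ((CurlOp (fine (nP i.P) (MP i.P)) ((nP i.P : ℕ) : ℂ))ᴴ *ᵥ
          (CurlOp (fine (nP i.P) (MP i.P)) ((nP i.P : ℕ) : ℂ) *ᵥ A)) = J →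
      RT (nP i.P) (MP i.P) *ᵥ ((GradOp (fine (nP i.P) (MP i.P)) ((nP i.P : ℕ) : ℂ))ᴴ *ᵥ A) = 0 →
      QvOp (nP i.P) (MP i.P) *ᵥ A = B₁ →
      0 ≤ α₂ →
      supNorm univ J ≤ 2 * α₀ + 36 * d * α₂ *
          supNorm univ (fun p : Fin i.P.d × (Tor (fine (nP i.P) (MP i.P)) × Fin i.P.d) => grad (nP i.P) (MP i.P) A p.1 p.2)
        + 50 * d * α₂ ^ 3 + 10 * d * α₀ * α₂ →
      supNorm univ B₁ ≤ 2 * d * L * α₁ + C₂ * α₂ ^ 2 →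
      36 * d * B₀ * α₂ ≤ 1 / 2 → 50 * d * α₂ ≤ 1 →
      (∀ b, ‖A b‖ ≤ B₀ * (4 * α₀ + 4 * d * L * α₁ + 2 * α₂ ^ 2 + 20 * d * α₀ * α₂ + 2 * C₂ * α₂ ^ 2)) ∧
      (∀ ν b, ‖grad (nP i.P) (MP i.P) A ν b‖
          ≤ B₀ * (4 * α₀ + 4 * d * L * α₁ + 2 * α₂ ^ 2 + 20 * d * α₀ * α₂ + 2 * C₂ * α₂ ^ 2)) ∧
      (∀ b, ‖((1 / 2 : ℂ) • ((CurlOp (fine (nP i.P) (MP i.P)) ((nP i.P : ℕ) : ℂ))ᴴ *ᵥ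
          (CurlOp (fine (nP i.P) (MP i.P)) ((nP i.P : ℕ) : ℂ) *ᵥ A))) b‖
          ≤ B₀ * (4 * α₀ + 4 * d * L * α₁ + 2 * α₂ ^ 2 + 20 * d * α₀ * α₂ + 2 * C₂ * α₂ ^ 2)) ∧
      (∀ b, ‖(Lap (nP i.P) (MP i.P) *ᵥ A) b‖
          ≤ B₀ * (4 * α₀ + 4 * d * L * α₁ + 2 * α₂ ^ 2 + 20 * d * α₀ * α₂ + 2 * C₂ * α₂ ^ 2)) := by
  obtain ⟨B₀, hB₀, h⟩ := ineq159_flat_printed hd hL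
  refine ⟨B₀, hB₀, fun i J A B₁ α₀ α₁ α₂ C₂ h55 h42 h56 hα₂ hJ hB hside h50 => ?_⟩
  obtain ⟨hAb, hgr, hdd, hlap⟩ := h i J A B₁ h55 h42 h56
  have hB₀' : 0 ≤ B₀ := zero_le_one.trans hB₀
  have hsum : 0 ≤ B₀ * (supNorm univ J + supNorm univ B₁) :=
    mul_nonneg hB₀' (add_nonneg (supNorm_nonneg _ _) (supNorm_nonneg _ _))
  -- the four norms of (1.59) as numbers
  set gF : Fin i.P.d × (Tor (fine (nP i.P) (MP i.P)) × Fin i.P.d) → ℂ :=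
    fun p => grad (nP i.P) (MP i.P) A p.1 p.2 with hgF
  set DD : Tor (fine (nP i.P) (MP i.P)) × Fin i.P.d → ℂ :=
    (1 / 2 : ℂ) • ((CurlOp (fine (nP i.P) (MP i.P)) ((nP i.P : ℕ) : ℂ))ᴴ *ᵥ
      (CurlOp (fine (nP i.P) (MP i.P)) ((nP i.P : ℕ) : ℂ) *ᵥ A)) with hDD
  have h59a : supNorm univ A ≤ B₀ * (supNorm univ J + supNorm univ B₁) := supNorm_le hsum fun b _ => hAb b
  have h59g : supNorm univ gF ≤ B₀ * (supNorm univ J + supNorm univ B₁) := supNorm_le hsum fun p _ => hgr p.1 p.2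
  have h59j : supNorm univ DD ≤ B₀ * (supNorm univ J + supNorm univ B₁) := supNorm_le hsum fun b _ => hdd b
  have h59l : supNorm univ (Lap (nP i.P) (MP i.P) *ᵥ A) ≤ B₀ * (supNorm univ J + supNorm univ B₁) :=
    supNorm_le hsum fun b _ => hlap b
  have hdR : (0 : ℝ) ≤ d := Nat.cast_nonneg d
  obtain ⟨ha, hg, hj, hl⟩ := B8.apriori_160 (L := (L : ℝ)) (C₂ := C₂) (α₁ := α₁) hdR hB₀' hα₂ (supNorm_nonneg _ gF)
    hJ hB h59a h59g h59j h59l hside h50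
  exact ⟨fun b => (norm_le_supNorm A (Finset.mem_univ b)).trans ha,
    fun ν b => (norm_le_supNorm gF (Finset.mem_univ (ν, b))).trans hg,
    fun b => (norm_le_supNorm DD (Finset.mem_univ b)).trans hj,
    fun b => (norm_le_supNorm (Lap (nP i.P) (MP i.P) *ᵥ A) (Finset.mem_univ b)).trans hl⟩

/-- **PROPOSITION 3 / (1.62) AT THE FLAT BACKGROUND U₀ = 1, constant domain sequence, on every torus of record** (p. 86, last line:
*"Now we assume further that 2α₂² + 20dα₀α₂ + 2C₂α₂² ≦ α₀ + α₁. (1.61)"*; p. 87: *"This and the previous inequality give finally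
|A| < 5dLB₀(α₀ + α₁)(L^jη)⁻¹, |∇^η_{U₀}A| < 5dLB₀(α₀ + α₁)(L^jη)⁻², ‖A‖_{1,β} < 5dLB₀(β)(α₀ + α₁)(L^jη)^{−2−β}, |D^{η*}_{U₀}D^η_{U₀}A|,
|Δ^η_{U₀}A| < 5dLB₀(α₀ + α₁)(L^jη)⁻³ on Ω_j. (1.62)"*; Prop. 3: *"If U₀, U₁U₀ satisfy (1.40)–(1.42) with α₀, α₁, α₂ bounded by a
constant depending on d and L only, and α₂ satisfies the additional restriction (1.61), then U₁ satisfies (1.36)–(1.39) with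
B₁ = 5dLB₀, B₂(β₀) = 5dLB₀(β₀), where B₀, B₀(β₀) are the corresponding norms of the operators G(U₀), H(U₀), and depend on d and L
only, B₀(β₀) on β₀ also."*): with ONE B₀ = B₀(d, L) ≥ 1 (that of `ineq159_flat`), for every torus of record and every A with
(1.55)/(1.42)/(1.56) (L^kη = 1, so the factors (L^jη)^{−1,−2,−3} of (1.62) are 1 at the single surviving level) whose sources obey the
printed |J|- and |B₁|-lines, under the p. 86 side condition 36dB₀α₂ ≦ ½ (+ 50dα₂ ≦ 1) and (1.61): `|A|, |∇A|, |D*DA|, |ΔA| ≦ 5dLB₀(α₀ + α₁)`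
POINTWISE — the |A|-, ∇- and second-order members of (1.36)/(1.39) with the printed B₁ = 5dLB₀.  This is `B8.apriori_162` ∘
`apriori_160_flat`.  NOT part of this instance: the Hölder member ‖A‖_{1,β} of (1.62) (operator H(U₀), constant B₀(β₀); the β-Hölder
norm is not modelled in the torus files).  HONEST SCOPE as §4: U₀ = 1 / one level only; general backgrounds = [4] Thm 3.3 (leaf
`B9.Thm33Printed`) + `B8Prop3Concrete` (p40; ℤᵈ carriers, modulo (1.59)); the abstract statement of record stays `B8.Prop3Printed`
(row B8.Prop3 head unchanged).
[cite: Balaban1985RegularSpaces, Prop. 3 + (1.61)–(1.62) pp.86–87, (1.55)–(1.60) p.86] -/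
theorem prop3_flat (hd : 1 ≤ d) (hL : Odd L ∧ 1 < L) :
    ∃ B₀ : ℝ, 1 ≤ B₀ ∧ ∀ (i : TopIdx d L) (J A : Tor (fine (nP i.P) (MP i.P)) × Fin i.P.d → ℂ)
      (B₁ : Tor (MP i.P) × Fin i.P.d → ℂ) (α₀ α₁ α₂ C₂ : ℝ),
      (1 / 2 : ℂ) • ((CurlOp (fine (nP i.P) (MP i.P)) ((nP i.P : ℕ) : ℂ))ᴴ *ᵥ
          (CurlOp (fine (nP i.P) (MP i.P)) ((nP i.P : ℕ) : ℂ) *ᵥ A)) = J →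
      RT (nP i.P) (MP i.P) *ᵥ ((GradOp (fine (nP i.P) (MP i.P)) ((nP i.P : ℕ) : ℂ))ᴴ *ᵥ A) = 0 →
      QvOp (nP i.P) (MP i.P) *ᵥ A = B₁ →
      0 ≤ α₀ → 0 ≤ α₁ → 0 ≤ α₂ →
      supNorm univ J ≤ 2 * α₀ + 36 * d * α₂ *
          supNorm univ (fun p : Fin i.P.d × (Tor (fine (nP i.P) (MP i.P)) × Fin i.P.d) => grad (nP i.P) (MP i.P) A p.1 p.2)
        + 50 * d * α₂ ^ 3 + 10 * d * α₀ * α₂ →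
      supNorm univ B₁ ≤ 2 * d * L * α₁ + C₂ * α₂ ^ 2 →
      36 * d * B₀ * α₂ ≤ 1 / 2 → 50 * d * α₂ ≤ 1 →
      2 * α₂ ^ 2 + 20 * d * α₀ * α₂ + 2 * C₂ * α₂ ^ 2 ≤ α₀ + α₁ →
      (∀ b, ‖A b‖ ≤ 5 * d * L * B₀ * (α₀ + α₁)) ∧
      (∀ ν b, ‖grad (nP i.P) (MP i.P) A ν b‖ ≤ 5 * d * L * B₀ * (α₀ + α₁)) ∧
      (∀ b, ‖((1 / 2 : ℂ) • ((CurlOp (fine (nP i.P) (MP i.P)) ((nP i.P : ℕ) : ℂ))ᴴ *ᵥ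
          (CurlOp (fine (nP i.P) (MP i.P)) ((nP i.P : ℕ) : ℂ) *ᵥ A))) b‖ ≤ 5 * d * L * B₀ * (α₀ + α₁)) ∧
      (∀ b, ‖(Lap (nP i.P) (MP i.P) *ᵥ A) b‖ ≤ 5 * d * L * B₀ * (α₀ + α₁)) := by
  obtain ⟨B₀, hB₀, h⟩ := apriori_160_flat hd hL
  refine ⟨B₀, hB₀, fun i J A B₁ α₀ α₁ α₂ C₂ h55 h42 h56 hα₀ hα₁ hα₂ hJ hB hside h50 h61 => ?_⟩
  obtain ⟨hAb, hgr, hdd, hlap⟩ := h i J A B₁ α₀ α₁ α₂ C₂ h55 h42 h56 hα₂ hJ hB hside h50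
  have hB₀' : 0 ≤ B₀ := zero_le_one.trans hB₀
  have hdL : (1 : ℝ) ≤ (d : ℝ) * (L : ℝ) := by
    have h1 : (1 : ℝ) ≤ d := by exact_mod_cast hd
    have h2 : (1 : ℝ) ≤ L := by exact_mod_cast hL.2.le
    nlinarith
  have h162 := B8.apriori_162 (C₂ := C₂) (α₂ := α₂) hB₀' hdL hα₀ hα₁ h61
  exact ⟨fun b => (hAb b).trans h162, fun ν b => (hgr ν b).trans h162, fun b => (hdd b).trans h162,
    fun b => (hlap b).trans h162⟩

end Prop3Flat


end Literature.MathematicalPhysics.QuantumFieldTheory.Balaban1983to89.B8Ineq159FlatTorus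

end
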